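import Summits.ValiantsHypothesis.ValiantsHypothesis.Theorems.KPlusLogSqLawTridiagonalRealStaticUnitSixChambers

/-!
# Route «KPlusLogSqLaw», crux `WeakLifting` (stmt-ValiantsHypothesis-19561) — REAL side of the tridiagonal sector:
# the UNIT-COEFFICIENT sub-sector at size `6` — SIGN-CHAMBER LAWS II: the MONOTONE OUTER CHAMBERS carry exactly one zero on their live side

HONEST FRAMING.  Helper theorems (`--supports stmt-ValiantsHypothesis-19561 --as helper`), seat val-sym-lift-p1 (g17), cell `pub-symmetroid`,
2026-08-28; sequel of `…UnitSixChambers` (two-triangle gauge `D₆ = x^E((1 − b₀ − b₁)(1 − b₃ − b₄) − b₂(1 − b₀)(1 − b₄))`, one-sided laws, the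
EMPTY chamber `+ − ? + −`, the EXACTLY-ONE chamber `+ + − + +`).  Slopes `L_t = 2f_t − d_t − d_{t+1}`, `b_t = x^{L_t}`; on `(1, ∞)` with
`L₀, L₄ > 0` the root equation reads `(1 + b₁/(b₀ − 1))·(1 + b₃/(b₄ − 1)) = b₂`.  Proved here, for ALL exponent data:
* `unit_six_monotone_aux` — if `L₁ < L₀`, `L₃ < L₄` (with `L₀, L₄ > 0`) and `L₂ > 0`, two distinct zeros in `(1, ∞)` are impossible: both secular
  factors `1 + b₁/(b₀ − 1) = 1 + x^{L₁−L₀}/(1 − x^{−L₀})` decrease strictly while `b₂` increases strictly;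
* `unit_six_monotone_eval_five_neg` — in that chamber `D₆(5) < 0` uniformly in the exponents (`b₁/(b₀ − 1) ≤ 1/4`, `b₂ ≥ 5`), so with `D₆(1) = 1`
  the intermediate value theorem puts a zero in `(1, 5)`;
* **MONOTONE OUTER CHAMBER LAW** (`card_posRoots_gt_one_unit_six_eq_one`): `0 < L₀`, `L₁ < L₀`, `0 < L₄`, `L₃ < L₄`, `0 < L₂` ⇒ EXACTLY ONE
  determinant zero in `(1, ∞)`; mirror (`card_posRoots_lt_one_unit_six_eq_one`, by `x ↦ 1/x`): `L₀ < 0`, `L₀ < L₁`, `L₄ < 0`, `L₄ < L₃`, `L₂ < 0`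
  ⇒ EXACTLY ONE zero in `(0, 1)`.  In particular the whole sign class `+ − + − +` has exactly one zero above `1`.
LOCATED CONTEXT (this seat; grid census of the ten sign classes of `(L₀,…,L₄)` modulo reversal and `x ↦ 1/x`, 22⁴ slope ratios ≤ 2500 each, counts
`(zeros below 1, zeros above 1)`): `+++++` {(2,0),(2,1)}; `++++−` {(1,0),(3,0)}; `+++−+` {(1,0),(1,1),(3,1)}; `+++−−` {(1,0),(1,1),(1,2)} (the kernel
`U 6 ≥ 4` witness `(260,14,−51,−68,−16)` of p613828 lies in this class, off the grid); `++−++` {(1,0)} (= the EXACTLY-ONE chamber); `++−+−`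
{(0,0),(2,0)}; `++−−+` {(1,0)}; `+−++−` {(0,0)} (= the EMPTY chamber); `+−+−+` {(0,1),(2,1)} (above = 1: this file); `+−−−+` {(0,0),(1,0),(2,0)}.
No unit `6`-design with five positive zeros was found (grid + ≈ 10⁶ near-resonant multi-scale integer designs); `U 6 ≥ 4` stands.  Nothing here is an
upper law for the register (α NO MOVER); nothing bears on `WeakLifting` / `TropicalB` (stmt-19771) in their windows, Conjecture B, the Door-A registers,
`MatrixDescartes` (stmt-18050) or VP ≠ VNP.
[this seat; folklore: intermediate value theorem]
-/

-- `Summit.ValiantsHypothesis.ValiantsHypothesis.…` repeats a component by the D-0017 layout (single-conjunct summit); the name is mandated.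
set_option linter.dupNamespace false
set_option autoImplicit false

namespace Summit.ValiantsHypothesis.ValiantsHypothesis.Theorems.KPlusLogSqLaw
namespace StaticTridiagonalRealUnit

open Polynomial Finset
open Summit.ValiantsHypothesis.ValiantsHypothesis.Theorems.KPlusLogSqLaw.StaticTridiagonalRealPotential (pathDet)

variable (d : ℕ → ℕ) (f : ℕ → ℕ)

/-! ### The monotone outer chamber on `(1, ∞)` -/

/-- the secular factor `x^{L₁}/(x^{L₀} − 1)` is strictly DECREASING on `(1, ∞)` when `L₁ < L₀` and `0 < L₀`
(it equals `x^{L₁−L₀}/(1 − x^{−L₀})`: decreasing numerator, increasing positive denominator). [elementary] -/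
theorem secular_factor_strictAnti (L₀ L₁ : ℤ) (h0 : 0 < L₀) (h10 : L₁ < L₀) {x y : ℝ} (hx : 1 < x) (hxy : x < y) :
    y ^ L₁ / (y ^ L₀ - 1) < x ^ L₁ / (x ^ L₀ - 1) := by
  have hx0 : 0 < x := one_pos.trans hx
  have hy : 1 < y := hx.trans hxy
  have hy0 : 0 < y := hx0.trans hxy
  have cx : 0 < x ^ L₀ - 1 := sub_pos.2 (one_lt_zpow₀ hx h0)
  have cy : 0 < y ^ L₀ - 1 := sub_pos.2 (one_lt_zpow₀ hy h0)
  -- rewrite `z^{L₁}/(z^{L₀} − 1) = z^{L₁−L₀}/(1 − z^{−L₀})`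
  have key : ∀ z : ℝ, 0 < z → 0 < z ^ L₀ - 1 → z ^ L₁ / (z ^ L₀ - 1) = z ^ (L₁ - L₀) / (1 - z ^ (-L₀)) := by
    intro z hz hc
    have hzL : z ^ L₀ ≠ 0 := (zpow_pos hz _).ne'
    rw [zpow_sub₀ hz.ne', zpow_neg, div_div, mul_sub, mul_one, mul_inv_cancel₀ hzL]
  rw [key x hx0 cx, key y hy0 cy]
  have nx : 0 < 1 - x ^ (-L₀) := sub_pos.2 (zpow_lt_one_of_neg₀ hx (by omega))
  have ny : 0 < 1 - y ^ (-L₀) := sub_pos.2 (zpow_lt_one_of_neg₀ hy (by omega))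
  have e1 : y ^ (L₁ - L₀) < x ^ (L₁ - L₀) := zpow_lt_zpow_left_of_neg (by omega) hx0 hxy
  have e0 : y ^ (-L₀) < x ^ (-L₀) := zpow_lt_zpow_left_of_neg (by omega) hx0 hxy
  calc y ^ (L₁ - L₀) / (1 - y ^ (-L₀)) < x ^ (L₁ - L₀) / (1 - y ^ (-L₀)) := div_lt_div_of_pos_right e1 ny
    _ ≤ x ^ (L₁ - L₀) / (1 - x ^ (-L₀)) := div_le_div_of_nonneg_left (zpow_pos hx0 _).le nx (by linarith)

/-- in the chamber `0 < L₀`, `L₁ < L₀`, `0 < L₄`, `L₃ < L₄`, `0 < L₂`, two distinct zeros in `(1, ∞)` are impossible: there the root equation is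
`(1 + b₁/(b₀ − 1))(1 + b₃/(b₄ − 1)) = b₂` with strictly decreasing left factors and strictly increasing `b₂`. [this file] -/
theorem unit_six_monotone_aux (L₀ L₁ L₂ L₃ L₄ : ℤ) (h0 : 0 < L₀) (h10 : L₁ < L₀) (h4 : 0 < L₄) (h34 : L₃ < L₄) (h2 : 0 < L₂)
    {x y : ℝ} (hx : 1 < x) (hxy : x < y)
    (hxr : (1 - x ^ L₀ - x ^ L₁) * (1 - x ^ L₃ - x ^ L₄) = x ^ L₂ * (1 - x ^ L₀) * (1 - x ^ L₄))
    (hyr : (1 - y ^ L₀ - y ^ L₁) * (1 - y ^ L₃ - y ^ L₄) = y ^ L₂ * (1 - y ^ L₀) * (1 - y ^ L₄)) : False := by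
  have hx0 : 0 < x := one_pos.trans hx
  have hy : 1 < y := hx.trans hxy
  have hy0 : 0 < y := hx0.trans hxy
  have cx : 0 < x ^ L₀ - 1 := sub_pos.2 (one_lt_zpow₀ hx h0)
  have cy : 0 < y ^ L₀ - 1 := sub_pos.2 (one_lt_zpow₀ hy h0)
  have dx : 0 < x ^ L₄ - 1 := sub_pos.2 (one_lt_zpow₀ hx h4)
  have dy : 0 < y ^ L₄ - 1 := sub_pos.2 (one_lt_zpow₀ hy h4)
  -- secular form
  have sec : ∀ z : ℝ, 0 < z ^ L₀ - 1 → 0 < z ^ L₄ - 1 →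
      (1 - z ^ L₀ - z ^ L₁) * (1 - z ^ L₃ - z ^ L₄) = z ^ L₂ * (1 - z ^ L₀) * (1 - z ^ L₄) →
      (1 + z ^ L₁ / (z ^ L₀ - 1)) * (1 + z ^ L₃ / (z ^ L₄ - 1)) = z ^ L₂ := by
    intro z hc hd h
    field_simp
    linarith
  have fx := sec x cx dx hxr
  have fy := sec y cy dy hyr
  have m1 := secular_factor_strictAnti L₀ L₁ h0 h10 hx hxy
  have m3 := secular_factor_strictAnti L₄ L₃ h4 h34 hx hxy
  have gy : 0 < 1 + y ^ L₁ / (y ^ L₀ - 1) := by positivity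
  have hy' : 0 < 1 + y ^ L₃ / (y ^ L₄ - 1) := by positivity
  have prod : (1 + y ^ L₁ / (y ^ L₀ - 1)) * (1 + y ^ L₃ / (y ^ L₄ - 1)) <
      (1 + x ^ L₁ / (x ^ L₀ - 1)) * (1 + x ^ L₃ / (x ^ L₄ - 1)) :=
    mul_lt_mul'' (by linarith) (by linarith) gy.le hy'.le
  rw [fx, fy] at prod
  exact lt_asymm prod (zpow_lt_zpow_left₀ h2 hx0.le hxy)

/-- in the chamber `0 < L₀`, `L₁ < L₀`, `0 < L₄`, `L₃ < L₄`, `0 < L₂` the determinant is NEGATIVE at `x = 5`, uniformly in the exponents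
(`b₁ ≤ b₀/5`, `b₀ − 1 ≥ (4/5)·b₀`, so each secular factor is `≤ 5/4`, while `b₂ ≥ 5`). [this file] -/
theorem unit_six_monotone_eval_five_neg
    (h0 : 0 < (2 * f 0 : ℤ) - d 0 - d 1) (h10 : (2 * f 1 : ℤ) - d 1 - d 2 < (2 * f 0 : ℤ) - d 0 - d 1)
    (h4 : 0 < (2 * f 4 : ℤ) - d 4 - d 5) (h34 : (2 * f 3 : ℤ) - d 3 - d 4 < (2 * f 4 : ℤ) - d 4 - d 5)
    (h2 : 0 < (2 * f 2 : ℤ) - d 2 - d 3) :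
    (pathDet (fun _ => (1 : ℝ)) d (fun _ => (1 : ℝ)) f 6).eval 5 < 0 := by
  have hq : (5 : ℝ) ≠ 0 := by norm_num
  have hq0 : (0 : ℝ) < 5 := by norm_num
  have hq1 : (1 : ℝ) ≤ 5 := by norm_num
  rw [eval_unit_six_eq d f _ hq]
  set L₀ := (2 * f 0 : ℤ) - d 0 - d 1
  set L₁ := (2 * f 1 : ℤ) - d 1 - d 2
  set L₂ := (2 * f 2 : ℤ) - d 2 - d 3
  set L₃ := (2 * f 3 : ℤ) - d 3 - d 4
  set L₄ := (2 * f 4 : ℤ) - d 4 - d 5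
  -- integer slopes: `b₁ ≤ b₀ / 5`, `b₃ ≤ b₄ / 5`, `b₀, b₄, b₂ ≥ 5`
  have b0 : (5 : ℝ) ≤ (5 : ℝ) ^ L₀ := by
    have := zpow_le_zpow_right₀ hq1 (show (1 : ℤ) ≤ L₀ by omega); rwa [zpow_one] at this
  have b4 : (5 : ℝ) ≤ (5 : ℝ) ^ L₄ := by
    have := zpow_le_zpow_right₀ hq1 (show (1 : ℤ) ≤ L₄ by omega); rwa [zpow_one] at this
  have b2 : (5 : ℝ) ≤ (5 : ℝ) ^ L₂ := by
    have := zpow_le_zpow_right₀ hq1 (show (1 : ℤ) ≤ L₂ by omega); rwa [zpow_one] at this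
  have b1 : (5 : ℝ) ^ L₁ * 5 ≤ (5 : ℝ) ^ L₀ := by
    have := zpow_le_zpow_right₀ hq1 (show L₁ + 1 ≤ L₀ by omega); rwa [zpow_add_one₀ hq] at this
  have b3 : (5 : ℝ) ^ L₃ * 5 ≤ (5 : ℝ) ^ L₄ := by
    have := zpow_le_zpow_right₀ hq1 (show L₃ + 1 ≤ L₄ by omega); rwa [zpow_add_one₀ hq] at this
  have p1 := zpow_pos hq0 L₁
  have p3 := zpow_pos hq0 L₃
  have hE : (0 : ℝ) < (5 : ℝ) ^ (d 0 + d 1 + d 2 + d 3 + d 4 + d 5) := pow_pos hq0 _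
  apply mul_neg_of_pos_of_neg hE
  -- `A = C − b₁ < 0`, `B = D − b₃ < 0` with `|A| ≤ (5/4)|C|`, `|B| ≤ (5/4)|D|`; `AB ≤ (25/16) CD < 5 CD ≤ b₂ CD`
  have hC : (5 : ℝ) ^ L₀ - 1 > 0 := by linarith
  have hD : (5 : ℝ) ^ L₄ - 1 > 0 := by linarith
  have hA : (5 : ℝ) ^ L₀ - 1 + (5 : ℝ) ^ L₁ ≤ 5 / 4 * ((5 : ℝ) ^ L₀ - 1) := by nlinarith
  have hB : (5 : ℝ) ^ L₄ - 1 + (5 : ℝ) ^ L₃ ≤ 5 / 4 * ((5 : ℝ) ^ L₄ - 1) := by nlinarith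
  have hA0 : 0 < (5 : ℝ) ^ L₀ - 1 + (5 : ℝ) ^ L₁ := by linarith
  have hB0 : 0 < (5 : ℝ) ^ L₄ - 1 + (5 : ℝ) ^ L₃ := by linarith
  have hAB : ((5 : ℝ) ^ L₀ - 1 + (5 : ℝ) ^ L₁) * ((5 : ℝ) ^ L₄ - 1 + (5 : ℝ) ^ L₃) ≤
      (5 / 4 * ((5 : ℝ) ^ L₀ - 1)) * (5 / 4 * ((5 : ℝ) ^ L₄ - 1)) := mul_le_mul hA hB hB0.le (by linarith)
  have hCD : 0 < ((5 : ℝ) ^ L₀ - 1) * ((5 : ℝ) ^ L₄ - 1) := mul_pos hC hD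
  -- the gauge expression equals `AB − b₂·CD` with `A = −(C' + b₁)` etc. (`C' = b₀ − 1 = −C`)
  have e : (1 - (5 : ℝ) ^ L₀ - (5 : ℝ) ^ L₁) * (1 - (5 : ℝ) ^ L₃ - (5 : ℝ) ^ L₄) -
      (5 : ℝ) ^ L₂ * (1 - (5 : ℝ) ^ L₀) * (1 - (5 : ℝ) ^ L₄) =
      ((5 : ℝ) ^ L₀ - 1 + (5 : ℝ) ^ L₁) * ((5 : ℝ) ^ L₄ - 1 + (5 : ℝ) ^ L₃) -
        (5 : ℝ) ^ L₂ * (((5 : ℝ) ^ L₀ - 1) * ((5 : ℝ) ^ L₄ - 1)) := by ring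
  rw [e]
  nlinarith [mul_le_mul_of_nonneg_right b2 hCD.le]

/-- bookkeeping: the zeros of `D₆` above `1`, as a finset. -/
theorem mem_posRoots_gt_one_unit_six {x : ℝ}
    (hx : x ∈ (pathDet (fun _ => (1 : ℝ)) d (fun _ => (1 : ℝ)) f 6).roots.toFinset.filter (fun x => 1 < x)) :
    1 < x ∧ (pathDet (fun _ => (1 : ℝ)) d (fun _ => (1 : ℝ)) f 6).eval x = 0 := by
  simp only [Finset.mem_filter, Multiset.mem_toFinset, mem_roots', IsRoot.def] at hx
  exact ⟨hx.2, hx.1.2⟩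

/-- **MONOTONE OUTER CHAMBER LAW (live side above `1`).**  If `0 < L₀`, `L₁ < L₀`, `0 < L₄`, `L₃ < L₄` and `0 < L₂`, the unit `6 × 6` design
has EXACTLY ONE determinant zero in `(1, ∞)` (it lies in `(1, 5)`).  Covers the whole sign class `+ − + − +` and the sub-chambers
`L₁ < L₀, L₃ < L₄` of `+ + + + +`, `+ − + + +`. [this file] -/
theorem card_posRoots_gt_one_unit_six_eq_one
    (h0 : 0 < (2 * f 0 : ℤ) - d 0 - d 1) (h10 : (2 * f 1 : ℤ) - d 1 - d 2 < (2 * f 0 : ℤ) - d 0 - d 1)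
    (h4 : 0 < (2 * f 4 : ℤ) - d 4 - d 5) (h34 : (2 * f 3 : ℤ) - d 3 - d 4 < (2 * f 4 : ℤ) - d 4 - d 5)
    (h2 : 0 < (2 * f 2 : ℤ) - d 2 - d 3) :
    ((pathDet (fun _ => (1 : ℝ)) d (fun _ => (1 : ℝ)) f 6).roots.toFinset.filter (fun x => 1 < x)).card = 1 := by
  set P := pathDet (fun _ => (1 : ℝ)) d (fun _ => (1 : ℝ)) f 6 with hP
  set S := P.roots.toFinset.filter (fun x => 1 < x) with hS
  have hpos : 0 < P.eval 1 := by rw [hP, eval_unit_six_one]; exact one_pos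
  have hneg := unit_six_monotone_eval_five_neg d f h0 h10 h4 h34 h2
  have hcont : ContinuousOn (fun x => P.eval x) (Set.Icc (1 : ℝ) 5) := P.continuous.continuousOn
  obtain ⟨r, ⟨hr1, hr2⟩, hr⟩ := intermediate_value_Ioo' (show (1 : ℝ) ≤ 5 by norm_num) hcont ⟨hneg, hpos⟩
  have hrS : r ∈ S := by
    simp only [hS, Finset.mem_filter, Multiset.mem_toFinset, mem_roots', IsRoot.def]
    exact ⟨⟨unit_six_ne_zero d f, hr⟩, hr1⟩
  have hle : S.card ≤ 1 := Finset.card_le_one.2 fun x hx y hy => by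
    obtain ⟨hx1, hxr⟩ := mem_posRoots_gt_one_unit_six d f hx
    obtain ⟨hy1, hyr⟩ := mem_posRoots_gt_one_unit_six d f hy
    have hx0 : 0 < x := one_pos.trans hx1
    have hy0 : 0 < y := one_pos.trans hy1
    by_contra hne
    rcases lt_or_gt_of_ne hne with hlt | hgt
    · exact unit_six_monotone_aux _ _ _ _ _ h0 h10 h4 h34 h2 hx1 hlt (unit_six_root_eq d f hx0 hxr) (unit_six_root_eq d f hy0 hyr)
    · exact unit_six_monotone_aux _ _ _ _ _ h0 h10 h4 h34 h2 hy1 hgt (unit_six_root_eq d f hy0 hyr) (unit_six_root_eq d f hx0 hxr)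
  have hge : 1 ≤ S.card := Finset.card_pos.2 ⟨r, hrS⟩
  omega

/-! ### The mirror chamber (live side below `1`), by `x ↦ 1/x` -/

/-- in the chamber `L₀ < 0`, `L₀ < L₁`, `L₄ < 0`, `L₄ < L₃`, `L₂ < 0`, two distinct zeros in `(0, 1)` are impossible (transport of
`unit_six_monotone_aux` along `x ↦ x⁻¹`). [this file] -/
theorem unit_six_monotone_aux' (L₀ L₁ L₂ L₃ L₄ : ℤ) (h0 : L₀ < 0) (h10 : L₀ < L₁) (h4 : L₄ < 0) (h34 : L₄ < L₃) (h2 : L₂ < 0)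
    {x y : ℝ} (hx : 0 < x) (hxy : x < y) (hy : y < 1)
    (hxr : (1 - x ^ L₀ - x ^ L₁) * (1 - x ^ L₃ - x ^ L₄) = x ^ L₂ * (1 - x ^ L₀) * (1 - x ^ L₄))
    (hyr : (1 - y ^ L₀ - y ^ L₁) * (1 - y ^ L₃ - y ^ L₄) = y ^ L₂ * (1 - y ^ L₀) * (1 - y ^ L₄)) : False := by
  have hy0 : 0 < y := hx.trans hxy
  refine unit_six_monotone_aux (-L₀) (-L₁) (-L₂) (-L₃) (-L₄) (by omega) (by omega) (by omega) (by omega) (by omega)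
    (x := y⁻¹) (y := x⁻¹) ((one_lt_inv₀ hy0).2 hy) ((inv_lt_inv₀ hy0 hx).2 hxy) ?_ ?_
  · simp only [unit_six_inv_aux]; exact hyr
  · simp only [unit_six_inv_aux]; exact hxr

/-- in the mirror chamber the determinant is NEGATIVE at `x = 1/5`. [this file] -/
theorem unit_six_monotone_eval_fifth_neg
    (h0 : (2 * f 0 : ℤ) - d 0 - d 1 < 0) (h10 : (2 * f 0 : ℤ) - d 0 - d 1 < (2 * f 1 : ℤ) - d 1 - d 2)
    (h4 : (2 * f 4 : ℤ) - d 4 - d 5 < 0) (h34 : (2 * f 4 : ℤ) - d 4 - d 5 < (2 * f 3 : ℤ) - d 3 - d 4)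
    (h2 : (2 * f 2 : ℤ) - d 2 - d 3 < 0) :
    (pathDet (fun _ => (1 : ℝ)) d (fun _ => (1 : ℝ)) f 6).eval (1 / 5) < 0 := by
  have hq : (1 / 5 : ℝ) ≠ 0 := by norm_num
  have hq0 : (0 : ℝ) < 1 / 5 := by norm_num
  rw [eval_unit_six_eq d f _ hq]
  set L₀ := (2 * f 0 : ℤ) - d 0 - d 1
  set L₁ := (2 * f 1 : ℤ) - d 1 - d 2
  set L₂ := (2 * f 2 : ℤ) - d 2 - d 3
  set L₃ := (2 * f 3 : ℤ) - d 3 - d 4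
  set L₄ := (2 * f 4 : ℤ) - d 4 - d 5
  -- `(1/5)^L = 5^(−L)`
  have inv : ∀ L : ℤ, (1 / 5 : ℝ) ^ L = (5 : ℝ) ^ (-L) := fun L => by rw [one_div, inv_zpow', ]
  simp only [inv]
  have hq1 : (1 : ℝ) ≤ 5 := by norm_num
  have hq5 : (5 : ℝ) ≠ 0 := by norm_num
  have b0 : (5 : ℝ) ≤ (5 : ℝ) ^ (-L₀) := by
    have := zpow_le_zpow_right₀ hq1 (show (1 : ℤ) ≤ -L₀ by omega); rwa [zpow_one] at this
  have b4 : (5 : ℝ) ≤ (5 : ℝ) ^ (-L₄) := by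
    have := zpow_le_zpow_right₀ hq1 (show (1 : ℤ) ≤ -L₄ by omega); rwa [zpow_one] at this
  have b2 : (5 : ℝ) ≤ (5 : ℝ) ^ (-L₂) := by
    have := zpow_le_zpow_right₀ hq1 (show (1 : ℤ) ≤ -L₂ by omega); rwa [zpow_one] at this
  have b1 : (5 : ℝ) ^ (-L₁) * 5 ≤ (5 : ℝ) ^ (-L₀) := by
    have := zpow_le_zpow_right₀ hq1 (show -L₁ + 1 ≤ -L₀ by omega); rwa [zpow_add_one₀ hq5] at this
  have b3 : (5 : ℝ) ^ (-L₃) * 5 ≤ (5 : ℝ) ^ (-L₄) := by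
    have := zpow_le_zpow_right₀ hq1 (show -L₃ + 1 ≤ -L₄ by omega); rwa [zpow_add_one₀ hq5] at this
  have p1 := zpow_pos (show (0:ℝ) < 5 by norm_num) (-L₁)
  have p3 := zpow_pos (show (0:ℝ) < 5 by norm_num) (-L₃)
  have hE : (0 : ℝ) < (1 / 5 : ℝ) ^ (d 0 + d 1 + d 2 + d 3 + d 4 + d 5) := pow_pos hq0 _
  apply mul_neg_of_pos_of_neg hE
  have hC : (5 : ℝ) ^ (-L₀) - 1 > 0 := by linarith
  have hD : (5 : ℝ) ^ (-L₄) - 1 > 0 := by linarith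
  have hA : (5 : ℝ) ^ (-L₀) - 1 + (5 : ℝ) ^ (-L₁) ≤ 5 / 4 * ((5 : ℝ) ^ (-L₀) - 1) := by nlinarith
  have hB : (5 : ℝ) ^ (-L₄) - 1 + (5 : ℝ) ^ (-L₃) ≤ 5 / 4 * ((5 : ℝ) ^ (-L₄) - 1) := by nlinarith
  have hA0 : 0 < (5 : ℝ) ^ (-L₀) - 1 + (5 : ℝ) ^ (-L₁) := by linarith
  have hB0 : 0 < (5 : ℝ) ^ (-L₄) - 1 + (5 : ℝ) ^ (-L₃) := by linarith
  have hAB : ((5 : ℝ) ^ (-L₀) - 1 + (5 : ℝ) ^ (-L₁)) * ((5 : ℝ) ^ (-L₄) - 1 + (5 : ℝ) ^ (-L₃)) ≤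
      (5 / 4 * ((5 : ℝ) ^ (-L₀) - 1)) * (5 / 4 * ((5 : ℝ) ^ (-L₄) - 1)) := mul_le_mul hA hB hB0.le (by linarith)
  have hCD : 0 < ((5 : ℝ) ^ (-L₀) - 1) * ((5 : ℝ) ^ (-L₄) - 1) := mul_pos hC hD
  have e : (1 - (5 : ℝ) ^ (-L₀) - (5 : ℝ) ^ (-L₁)) * (1 - (5 : ℝ) ^ (-L₃) - (5 : ℝ) ^ (-L₄)) -
      (5 : ℝ) ^ (-L₂) * (1 - (5 : ℝ) ^ (-L₀)) * (1 - (5 : ℝ) ^ (-L₄)) =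
      ((5 : ℝ) ^ (-L₀) - 1 + (5 : ℝ) ^ (-L₁)) * ((5 : ℝ) ^ (-L₄) - 1 + (5 : ℝ) ^ (-L₃)) -
        (5 : ℝ) ^ (-L₂) * (((5 : ℝ) ^ (-L₀) - 1) * ((5 : ℝ) ^ (-L₄) - 1)) := by ring
  rw [e]
  nlinarith [mul_le_mul_of_nonneg_right b2 hCD.le]

/-- **MONOTONE OUTER CHAMBER LAW (live side below `1`).**  If `L₀ < 0`, `L₀ < L₁`, `L₄ < 0`, `L₄ < L₃` and `L₂ < 0`, the unit `6 × 6` design has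
EXACTLY ONE determinant zero in `(0, 1)` (it lies in `(1/5, 1)`). [this file] -/
theorem card_posRoots_lt_one_unit_six_eq_one
    (h0 : (2 * f 0 : ℤ) - d 0 - d 1 < 0) (h10 : (2 * f 0 : ℤ) - d 0 - d 1 < (2 * f 1 : ℤ) - d 1 - d 2)
    (h4 : (2 * f 4 : ℤ) - d 4 - d 5 < 0) (h34 : (2 * f 4 : ℤ) - d 4 - d 5 < (2 * f 3 : ℤ) - d 3 - d 4)
    (h2 : (2 * f 2 : ℤ) - d 2 - d 3 < 0) :
    ((pathDet (fun _ => (1 : ℝ)) d (fun _ => (1 : ℝ)) f 6).roots.toFinset.filter (fun x => 0 < x ∧ x < 1)).card = 1 := by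
  set P := pathDet (fun _ => (1 : ℝ)) d (fun _ => (1 : ℝ)) f 6 with hP
  set S := P.roots.toFinset.filter (fun x => 0 < x ∧ x < 1) with hS
  have hpos : 0 < P.eval 1 := by rw [hP, eval_unit_six_one]; exact one_pos
  have hneg := unit_six_monotone_eval_fifth_neg d f h0 h10 h4 h34 h2
  have hcont : ContinuousOn (fun x => P.eval x) (Set.Icc (1 / 5 : ℝ) 1) := P.continuous.continuousOn
  obtain ⟨r, ⟨hr1, hr2⟩, hr⟩ := intermediate_value_Ioo (show (1 / 5 : ℝ) ≤ 1 by norm_num) hcont ⟨hneg, hpos⟩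
  have hrS : r ∈ S := by
    simp only [hS, Finset.mem_filter, Multiset.mem_toFinset, mem_roots', IsRoot.def]
    exact ⟨⟨unit_six_ne_zero d f, hr⟩, by linarith, hr2⟩
  have mem : ∀ x, x ∈ S → (0 < x ∧ x < 1) ∧ P.eval x = 0 := by
    intro x hx
    simp only [hS, Finset.mem_filter, Multiset.mem_toFinset, mem_roots', IsRoot.def] at hx
    exact ⟨hx.2, hx.1.2⟩
  have hle : S.card ≤ 1 := Finset.card_le_one.2 fun x hx y hy => by
    obtain ⟨⟨hx0, hx1⟩, hxr⟩ := mem x hx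
    obtain ⟨⟨hy0, hy1⟩, hyr⟩ := mem y hy
    by_contra hne
    rcases lt_or_gt_of_ne hne with hlt | hgt
    · exact unit_six_monotone_aux' _ _ _ _ _ h0 h10 h4 h34 h2 hx0 hlt hy1 (unit_six_root_eq d f hx0 hxr) (unit_six_root_eq d f hy0 hyr)
    · exact unit_six_monotone_aux' _ _ _ _ _ h0 h10 h4 h34 h2 hy0 hgt hx1 (unit_six_root_eq d f hy0 hyr) (unit_six_root_eq d f hx0 hxr)
  have hge : 1 ≤ S.card := Finset.card_pos.2 ⟨r, hrS⟩
  omega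

end StaticTridiagonalRealUnit
end Summit.ValiantsHypothesis.ValiantsHypothesis.Theorems.KPlusLogSqLaw
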